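import Summits.ABC.IUTFork.Conditional.AbcOfSGenuineKTameRobustTate
import Summits.ABC.IUTFork.Conditional.AbcOfSGenuineKTameRobustRows1
import HarnessLib

/-!
# R-W table rows DECIDED (refuted side, S_H level) UNCONDITIONALLY — part 7: the R-W numerics lead's «DECIDABLE-NOW» list
# (the `3677`-triple at EVERY prime `11 ≤ l ≤ 367` by the TATE-EXACT local type; the `1061`-triple at EVERY prime `7 ≤ l ≤ 35` below the floor `30·l + 2`)

PROOF-ONLY file (no `def`, no new `Prop`, no instance) of the abc-iut cell (R-W seat abc-iut-W-ref-2, gen 4; director-abc g3 MINT-LIST BATCH 1, row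
«TARGETS.tsv kind TE rows 26–51» — delivered by gen 0; this file answers the R-W numerics lead's HOME/plan/rescue/R-W/DECIDABLE-NOW.tsv (sha16
802c4d486c8ca1dc, 2026-08-26T22:15Z): «the last 25 Szpiro-bad (known triple, l) of the N3 census with a named e-free decider and NO kernel theorem» —
22 rows of the triple `2·5¹⁰·13⁴ + 3¹⁵·7·31⁷·45817 = 11⁸·109²·3677³` at `l = 19, 23, 29, …, 113` and 3 rows of `3³·241³ + 5⁸·11⁹·19·61³ = 2¹⁵·17²·331·1061⁴`
at `l = 23, 29, 31`). TAKES NO SIDE on [IUTchIII] Cor. 3.12 or on any author. NO new engine; two instantiations, each UNIFORM IN THE PRIME `l`: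
* §1 `GenuineK.not_pilotKummerCompatHull_chosen_triple_3677_tate` — this seat's Tate-exact decider `GenuineK.not_pilotKummerCompatHull_chosen_triple_of_ten_top`
  (`AbcOfSGenuineKTameRobustTate`, p465202: `p ∉ {2, 3, 5, l}`, `10·l + 2 ≤ p`, `p^v ∥ abc` with `3 ∣ v`, `2l ≤ (l−3)·v`; underneath: `ord_p j(a/c) = −2v`
  (`Cor22.ord_jInv_ratPoint_triple_eq`) so `3 ∣ ord_p j` and every `u | p` of `T.K` has `e(u | p) ∣ 10·l ≤ p − 2` — Tate uniformisation + Serre 1972 n° 1.12,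
  `Literature/IUT/LogVolume/GenuineTowerLocalTypeTate` p464995 over `…/SubThetaFieldRamificationTateUnramified` p464241) at `p = 3677`, `v = 3`
  (`3677³ ∥ abc`): the integer side conditions read `10·l + 2 ≤ 3677 ⟺ l ≤ 367` and `2l ≤ 3(l−3) ⟺ 9 ≤ l`, so ONE theorem decides the refuted side at
  EVERY prime `11 ≤ l ≤ 367` — the 22 listed rows and every other prime of that range (`l = 11, 13, 17` are already `…TameRobustRows1`, by the `60·l + 2` floor).
* §2 `GenuineK.not_pilotKummerCompatHull_chosen_triple_1061_thirty` — abc-iut-w5-d107's robust tame-exact decider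
  `GenuineK.not_pilotKummerCompatHull_chosen_triple_of_thirty_top` (`AbcOfSGenuineKTameRobustThirty`: `p ∉ {2, 3, 5, l}`, `30·l + 2 ≤ p`, `p^v ∣ abc`,
  `2l ≤ (l−3)·v`; local type `e ∣ 30·l` of abc-iut-W-neg-1) at `p = 1061`, `v = 4`: `30·l + 2 ≤ 1061 ⟺ l ≤ 35`, `2l ≤ 4(l−3) ⟺ 6 ≤ l`, so ONE theorem
  decides EVERY prime `7 ≤ l ≤ 35` (`l = 13` is the parent's worked row `…_triple_1061_thirteen`, `l = 17` is `…TameRobustRows1`, `l = 7, 11, 19` are [LIN] rows).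
* §3 the two explicit-list corollaries `(hl : l ∈ […])` — exactly the 25 «DECIDABLE-NOW» rows, in the shape the numerics lead's tree scan reads.
Inputs per theorem are integer facts checked by `norm_num` / `omega` and the triples `isABCTriple_3677` (`…TameRobustRows1`), `isABCTriple_1061`
(`…TameRobustTriple`) BY NAME. Each theorem: at EVERY genuine Θ-volume datum `T` over `(ratPoint (a/c), l)` the hull-level clause S_H (chosen realising
ideles, pinned reading — the per-datum object of the window binders `hSHw`/`hSHwBad`) FAILS for every choice of the free context binders and Kummer datum.
NOT claimed: admissibility / Szpiro-badness / (P6) of `(ratPoint (a/c), l)` (the numerics census lists the 25 pairs as admissible and Szpiro-bad — a ROUTING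
signal, not a kernel fact) and non-emptiness of the datum type. HONEST SCOPE as in the parents: SHARP reading; per-label licence STRONGER than print;
«refuted as typed» ≠ «refuted in print»; nothing about the number-level Corollary; typed ≠ proved; instantiated ≠ endorsed.
[cite: Mochizuki2012, IUTchIII Cor. 3.12 Step (xi-f) p. 184; IUTchIV Thm. 1.10 proof Steps (ii)–(iii) p. 24–26, Cor. 2.2 (ii) proof p. 44]
[cite: Serre1972, §1.11–§1.12] [cite: MochizukiGenEll2010, Thm. 2.1 p. 11] [claim: Mochizuki2012, status: disputed] for every IUT sentence quoted.
-/

noncomputable section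

open Set Function NumberField IsDedekindDomain

namespace Summit.ABC.IUTFork.Conditional

open Thm311 Thm311.Real Cor312 Cor312Vol Cor312Prov Literature.IUT.LogThetaLattice Literature.IUT.LogVolume
  Literature.IUT.HodgeTheaters Literature.IUT.LogVolume.ThetaData Literature.IUT.LogVolume.Cor22
open Literature.NumberTheory.NumberFields Literature.NumberTheory.GaloisRepresentations.Ultrametric
open Literature.NumberTheory.DiophantineGeometry Literature.NumberTheory.DiophantineGeometry.GenEll Summit.ABC.ABC.Theorems

/-! ## §1. The `3677`-triple at every prime `11 ≤ l ≤ 367` (Tate-exact local type at `p = 3677`) -/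

/-- **The triple `2·5¹⁰·13⁴ + 3¹⁵·7·31⁷·45817 = 11⁸·109²·3677³` at EVERY prime `11 ≤ l ≤ 367` — REFUTED side, unconditionally, UNIFORM IN `l`.**
At `p = 3677` (`3677³ ∥ abc`, `3 ∣ 3`, so every place `u | 3677` of `T.K` has `e(u | 3677) ∣ 10·l ≤ 3670 ≤ 3675`; `3677 ∉ {2, 3, 5, l}`; floor
`10·l + 2 ≤ 3677 ⟺ l ≤ 367`; top label `j = l⋆`: `2l ≤ (l−3)·3 ⟺ 9 ≤ l`): for every `l` with `11 ≤ l ≤ 367` (the datum forces `l` prime) and EVERY genuine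
Θ-volume datum `T` over `(ratPoint (a/c), l)`, S_H FAILS for every choice of the free binders. Covers the 22 «DECIDABLE-NOW» rows `l = 19, 23, …, 113`
of this triple (HOME/plan/rescue/R-W/DECIDABLE-NOW.tsv; their listed deciders TE30 / TE-TATE `ten(3∣v)` at `p = 3677`) and every further prime `l ≤ 367`.
[cite: Mochizuki2012, IUTchIII Cor. 3.12 Step (xi-f) p. 184; IUTchIV Cor. 2.2 (ii) proof p. 44] [cite: Serre1972, §1.11–§1.12] [claim: Mochizuki2012, status: disputed] -/
theorem GenuineK.not_pilotKummerCompatHull_chosen_triple_3677_tate {l : ℕ} (hlo : 11 ≤ l) (hhi : l ≤ 367)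
    (T : Cor22.ThetaVolumeDatumAt (ratPoint (((2 * 5 ^ 10 * 13 ^ 4 : ℕ) : ℚ) / (11 ^ 8 * 109 ^ 2 * 3677 ^ 3 : ℕ))) l) :
    letI := T.instFieldF; letI := T.instNumberFieldF; letI := T.instAlgebraF; letI := T.instFieldK
    letI := T.instNumberFieldK; letI := T.instAlgebraK; letI := T.instFieldFbar; letI := T.instAlgebraFbar
    letI := T.instAlgebraKFbar; letI := T.instIsElliptic
    ∀ (M : Type) [Field M] [NumberField M]
      (archPk : ∀ (j : (thetaIndex (pilotDataOfK T.D T.K)).Label) (vQ : (thetaIndex (pilotDataOfK T.D T.K)).VQ),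
        Set ((logShellsDH (pilotDataOfK T.D T.K) (analyticLogv T.K)).Packet j vQ))
      (archSub : ∀ (j : (thetaIndex (pilotDataOfK T.D T.K)).Label) (v : (thetaIndex (pilotDataOfK T.D T.K)).V),
        Set ((logShellsDH (pilotDataOfK T.D T.K) (analyticLogv T.K)).Packet j ((thetaIndex (pilotDataOfK T.D T.K)).over v)))
      (Ψ : ℤ → ∀ v : (thetaIndex (pilotDataOfK T.D T.K)).V, v ∈ (thetaIndex (pilotDataOfK T.D T.K)).Vbad →
        Set ((logShellsDH (pilotDataOfK T.D T.K) (analyticLogv T.K)).StarPacket v))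
      (act : ℤ → ∀ v : (thetaIndex (pilotDataOfK T.D T.K)).V, v ∈ (thetaIndex (pilotDataOfK T.D T.K)).Vbad →
        (logShellsDH (pilotDataOfK T.D T.K) (analyticLogv T.K)).StarPacket v →
          Module.End ℚ ((logShellsDH (pilotDataOfK T.D T.K) (analyticLogv T.K)).StarPacket v))
      (Mmod : ℤ → ∀ j : (thetaIndex (pilotDataOfK T.D T.K)).LabelStar, Set ((logShellsDH (pilotDataOfK T.D T.K) (analyticLogv T.K)).GlobalPacket j.1))
      (region : ℤ → ∀ j : (thetaIndex (pilotDataOfK T.D T.K)).LabelStar, FinDivisor M → ∀ vQ : (thetaIndex (pilotDataOfK T.D T.K)).VQ,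
        Set ((logShellsDH (pilotDataOfK T.D T.K) (analyticLogv T.K)).Packet j.1 vQ))
      (frobAdm : ℤ → ℤ → ∀ (j : (thetaIndex (pilotDataOfK T.D T.K)).Label) (vQ : (thetaIndex (pilotDataOfK T.D T.K)).VQ),
        Set ((logShellsDH (pilotDataOfK T.D T.K) (analyticLogv T.K)).Packet j vQ) → Prop)
      (frobLogvol : ℤ → ℤ → ∀ (j : (thetaIndex (pilotDataOfK T.D T.K)).Label) (vQ : (thetaIndex (pilotDataOfK T.D T.K)).VQ),
        Set ((logShellsDH (pilotDataOfK T.D T.K) (analyticLogv T.K)).Packet j vQ) → ℝ)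
      (frobΨ : ℤ → ℤ → ∀ v : (thetaIndex (pilotDataOfK T.D T.K)).V, v ∈ (thetaIndex (pilotDataOfK T.D T.K)).Vbad →
        Set ((logShellsDH (pilotDataOfK T.D T.K) (analyticLogv T.K)).StarPacket v))
      (frobMmod : ℤ → ℤ → ∀ j : (thetaIndex (pilotDataOfK T.D T.K)).LabelStar, Set ((logShellsDH (pilotDataOfK T.D T.K) (analyticLogv T.K)).GlobalPacket j.1))
      (unitImage : ℤ → ℤ → ℕ → ∀ (j : (thetaIndex (pilotDataOfK T.D T.K)).Label) (vQ : (thetaIndex (pilotDataOfK T.D T.K)).VQ),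
        Set ((logShellsDH (pilotDataOfK T.D T.K) (analyticLogv T.K)).Packet j vQ))
      (ballImage : ℤ → ℤ → ∀ (j : (thetaIndex (pilotDataOfK T.D T.K)).Label) (vQ : (thetaIndex (pilotDataOfK T.D T.K)).VQ),
        Set ((logShellsDH (pilotDataOfK T.D T.K) (analyticLogv T.K)).Packet j vQ))
      (thetaDiv : ℤ → ℤ → LgpDivisor M (thetaIndex (pilotDataOfK T.D T.K)).lstar)
      (n : ℤ) {HT : Type} {LogLink : HT → HT → Type} {IsFull : ∀ {s t : HT}, LogLink s t → Prop}
      (lat : LGPGaussianLogThetaLattice LogLink IsFull)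
      {Frd : Type} {IsoF : Frd → Frd → Type} {Ob : Frd → Type} {realify : Frd → Frd} {Strip : Type}
      {IsoS : Strip → Strip → Type} {Mv : ∀ v : (thetaIndex (pilotDataOfK T.D T.K)).V, v ∈ (thetaIndex (pilotDataOfK T.D T.K)).Vbad → Type}
      [∀ v h, Monoid (Mv v h)]
      (sig : GlobalLGPFrobenioidSignature (thetaIndex (pilotDataOfK T.D T.K)).lstar (thetaIndex (pilotDataOfK T.D T.K)).V
        (· ∈ (thetaIndex (pilotDataOfK T.D T.K)).Vbad) Frd IsoF Ob realify Strip IsoS Mv)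
      (split : SplittingMonoids Mv) {ObΔ : Type} {N : ∀ v : (thetaIndex (pilotDataOfK T.D T.K)).V, v ∈ (thetaIndex (pilotDataOfK T.D T.K)).Vbad → Type}
      [∀ v h, Monoid (N v h)] (qData : QPilotData ObΔ N)
      (qK : ∀ v : (thetaIndex (pilotDataOfK T.D T.K)).V, v ∈ (thetaIndex (pilotDataOfK T.D T.K)).Vbad →
        Set ((logShellsDH (pilotDataOfK T.D T.K) (analyticLogv T.K)).StarPacket v)),
      ¬ Cor312Vol.PilotKummerCompatHull
          (LatticeSituation.ofShells (logShellsDH (pilotDataOfK T.D T.K) (analyticLogv T.K)) M archPk archSub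
            (summandPiecesPr (pilotDataOfK T.D T.K) (logvAnalytic_analyticLogv (F := T.K))).Adm
            (summandPiecesPr (pilotDataOfK T.D T.K) (logvAnalytic_analyticLogv (F := T.K))).logvol Ψ act Mmod region frobAdm frobLogvol frobΨ
            frobMmod unitImage ballImage thetaDiv)
          (settingPrVolSharp (pilotDataOfK T.D T.K) (logvAnalytic_analyticLogv (F := T.K)) M archPk archSub Ψ act Mmod region n lat sig split qData
            (exists_realising_qIdeles_pilotDataOfK T.D).choose (exists_realising_thetaIdeles_pilotDataOfK T.D).choose
            (exists_realising_qIdeles_pilotDataOfK T.D).choose_spec.1 (exists_realising_qIdeles_pilotDataOfK T.D).choose_spec.2.1)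
          (fun _ => Cor312.Setting.qRegion
            (settingPrVolSharp (pilotDataOfK T.D T.K) (logvAnalytic_analyticLogv (F := T.K)) M archPk archSub Ψ act Mmod region n lat sig split qData
              (exists_realising_qIdeles_pilotDataOfK T.D).choose (exists_realising_thetaIdeles_pilotDataOfK T.D).choose
              (exists_realising_qIdeles_pilotDataOfK T.D).choose_spec.1 (exists_realising_qIdeles_pilotDataOfK T.D).choose_spec.2.1)) qK :=
  GenuineK.not_pilotKummerCompatHull_chosen_triple_of_ten_top isABCTriple_3677 T ⟨3677, by norm_num⟩ (by norm_num) (by norm_num) (by norm_num)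
    (show (3677 : ℕ) ≠ l by omega) (show 10 * l + 2 ≤ 3677 by omega) 3 (by norm_num) (dvd_mul_of_dvd_right (by norm_num) _) (by norm_num)
    (by norm_num) (by omega)

/-! ## §2. The `1061`-triple at every prime `7 ≤ l ≤ 35` (prime floor `30·l + 2` at `p = 1061`) -/

/-- **The triple `3³·241³ + 5⁸·11⁹·19·61³ = 2¹⁵·17²·331·1061⁴` at EVERY prime `7 ≤ l ≤ 35` — REFUTED side, unconditionally, UNIFORM IN `l`.**
At `p = 1061` (`1061⁴ ∣ abc`, `1061 ∉ {2, 3, 5, l}`; floor `30·l + 2 ≤ 1061 ⟺ l ≤ 35`; top label `j = l⋆`: `2l ≤ (l−3)·4 ⟺ 6 ≤ l`): for every `l` with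
`7 ≤ l ≤ 35` and EVERY genuine Θ-volume datum `T` over `(ratPoint (a/c), l)`, S_H FAILS for every choice of the free binders — ONE instance of
abc-iut-w5-d107's `GenuineK.not_pilotKummerCompatHull_chosen_triple_of_thirty_top`. Covers the 3 «DECIDABLE-NOW» rows `l = 23, 29, 31` of this triple
(listed decider TE30 at `p = 1061`, `v = 4`). [cite: Mochizuki2012, IUTchIII Cor. 3.12 Step (xi-f) p. 184; IUTchIV Cor. 2.2 (ii) proof p. 44]
[claim: Mochizuki2012, status: disputed] -/
theorem GenuineK.not_pilotKummerCompatHull_chosen_triple_1061_thirty {l : ℕ} (hlo : 7 ≤ l) (hhi : l ≤ 35)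
    (T : Cor22.ThetaVolumeDatumAt (ratPoint (((3 ^ 3 * 241 ^ 3 : ℕ) : ℚ) / (2 ^ 15 * 17 ^ 2 * 331 * 1061 ^ 4 : ℕ))) l) :
    letI := T.instFieldF; letI := T.instNumberFieldF; letI := T.instAlgebraF; letI := T.instFieldK
    letI := T.instNumberFieldK; letI := T.instAlgebraK; letI := T.instFieldFbar; letI := T.instAlgebraFbar
    letI := T.instAlgebraKFbar; letI := T.instIsElliptic
    ∀ (M : Type) [Field M] [NumberField M]
      (archPk : ∀ (j : (thetaIndex (pilotDataOfK T.D T.K)).Label) (vQ : (thetaIndex (pilotDataOfK T.D T.K)).VQ),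
        Set ((logShellsDH (pilotDataOfK T.D T.K) (analyticLogv T.K)).Packet j vQ))
      (archSub : ∀ (j : (thetaIndex (pilotDataOfK T.D T.K)).Label) (v : (thetaIndex (pilotDataOfK T.D T.K)).V),
        Set ((logShellsDH (pilotDataOfK T.D T.K) (analyticLogv T.K)).Packet j ((thetaIndex (pilotDataOfK T.D T.K)).over v)))
      (Ψ : ℤ → ∀ v : (thetaIndex (pilotDataOfK T.D T.K)).V, v ∈ (thetaIndex (pilotDataOfK T.D T.K)).Vbad →
        Set ((logShellsDH (pilotDataOfK T.D T.K) (analyticLogv T.K)).StarPacket v))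
      (act : ℤ → ∀ v : (thetaIndex (pilotDataOfK T.D T.K)).V, v ∈ (thetaIndex (pilotDataOfK T.D T.K)).Vbad →
        (logShellsDH (pilotDataOfK T.D T.K) (analyticLogv T.K)).StarPacket v →
          Module.End ℚ ((logShellsDH (pilotDataOfK T.D T.K) (analyticLogv T.K)).StarPacket v))
      (Mmod : ℤ → ∀ j : (thetaIndex (pilotDataOfK T.D T.K)).LabelStar, Set ((logShellsDH (pilotDataOfK T.D T.K) (analyticLogv T.K)).GlobalPacket j.1))
      (region : ℤ → ∀ j : (thetaIndex (pilotDataOfK T.D T.K)).LabelStar, FinDivisor M → ∀ vQ : (thetaIndex (pilotDataOfK T.D T.K)).VQ,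
        Set ((logShellsDH (pilotDataOfK T.D T.K) (analyticLogv T.K)).Packet j.1 vQ))
      (frobAdm : ℤ → ℤ → ∀ (j : (thetaIndex (pilotDataOfK T.D T.K)).Label) (vQ : (thetaIndex (pilotDataOfK T.D T.K)).VQ),
        Set ((logShellsDH (pilotDataOfK T.D T.K) (analyticLogv T.K)).Packet j vQ) → Prop)
      (frobLogvol : ℤ → ℤ → ∀ (j : (thetaIndex (pilotDataOfK T.D T.K)).Label) (vQ : (thetaIndex (pilotDataOfK T.D T.K)).VQ),
        Set ((logShellsDH (pilotDataOfK T.D T.K) (analyticLogv T.K)).Packet j vQ) → ℝ)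
      (frobΨ : ℤ → ℤ → ∀ v : (thetaIndex (pilotDataOfK T.D T.K)).V, v ∈ (thetaIndex (pilotDataOfK T.D T.K)).Vbad →
        Set ((logShellsDH (pilotDataOfK T.D T.K) (analyticLogv T.K)).StarPacket v))
      (frobMmod : ℤ → ℤ → ∀ j : (thetaIndex (pilotDataOfK T.D T.K)).LabelStar, Set ((logShellsDH (pilotDataOfK T.D T.K) (analyticLogv T.K)).GlobalPacket j.1))
      (unitImage : ℤ → ℤ → ℕ → ∀ (j : (thetaIndex (pilotDataOfK T.D T.K)).Label) (vQ : (thetaIndex (pilotDataOfK T.D T.K)).VQ),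
        Set ((logShellsDH (pilotDataOfK T.D T.K) (analyticLogv T.K)).Packet j vQ))
      (ballImage : ℤ → ℤ → ∀ (j : (thetaIndex (pilotDataOfK T.D T.K)).Label) (vQ : (thetaIndex (pilotDataOfK T.D T.K)).VQ),
        Set ((logShellsDH (pilotDataOfK T.D T.K) (analyticLogv T.K)).Packet j vQ))
      (thetaDiv : ℤ → ℤ → LgpDivisor M (thetaIndex (pilotDataOfK T.D T.K)).lstar)
      (n : ℤ) {HT : Type} {LogLink : HT → HT → Type} {IsFull : ∀ {s t : HT}, LogLink s t → Prop}
      (lat : LGPGaussianLogThetaLattice LogLink IsFull)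
      {Frd : Type} {IsoF : Frd → Frd → Type} {Ob : Frd → Type} {realify : Frd → Frd} {Strip : Type}
      {IsoS : Strip → Strip → Type} {Mv : ∀ v : (thetaIndex (pilotDataOfK T.D T.K)).V, v ∈ (thetaIndex (pilotDataOfK T.D T.K)).Vbad → Type}
      [∀ v h, Monoid (Mv v h)]
      (sig : GlobalLGPFrobenioidSignature (thetaIndex (pilotDataOfK T.D T.K)).lstar (thetaIndex (pilotDataOfK T.D T.K)).V
        (· ∈ (thetaIndex (pilotDataOfK T.D T.K)).Vbad) Frd IsoF Ob realify Strip IsoS Mv)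
      (split : SplittingMonoids Mv) {ObΔ : Type} {N : ∀ v : (thetaIndex (pilotDataOfK T.D T.K)).V, v ∈ (thetaIndex (pilotDataOfK T.D T.K)).Vbad → Type}
      [∀ v h, Monoid (N v h)] (qData : QPilotData ObΔ N)
      (qK : ∀ v : (thetaIndex (pilotDataOfK T.D T.K)).V, v ∈ (thetaIndex (pilotDataOfK T.D T.K)).Vbad →
        Set ((logShellsDH (pilotDataOfK T.D T.K) (analyticLogv T.K)).StarPacket v)),
      ¬ Cor312Vol.PilotKummerCompatHull
          (LatticeSituation.ofShells (logShellsDH (pilotDataOfK T.D T.K) (analyticLogv T.K)) M archPk archSub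
            (summandPiecesPr (pilotDataOfK T.D T.K) (logvAnalytic_analyticLogv (F := T.K))).Adm
            (summandPiecesPr (pilotDataOfK T.D T.K) (logvAnalytic_analyticLogv (F := T.K))).logvol Ψ act Mmod region frobAdm frobLogvol frobΨ
            frobMmod unitImage ballImage thetaDiv)
          (settingPrVolSharp (pilotDataOfK T.D T.K) (logvAnalytic_analyticLogv (F := T.K)) M archPk archSub Ψ act Mmod region n lat sig split qData
            (exists_realising_qIdeles_pilotDataOfK T.D).choose (exists_realising_thetaIdeles_pilotDataOfK T.D).choose
            (exists_realising_qIdeles_pilotDataOfK T.D).choose_spec.1 (exists_realising_qIdeles_pilotDataOfK T.D).choose_spec.2.1)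
          (fun _ => Cor312.Setting.qRegion
            (settingPrVolSharp (pilotDataOfK T.D T.K) (logvAnalytic_analyticLogv (F := T.K)) M archPk archSub Ψ act Mmod region n lat sig split qData
              (exists_realising_qIdeles_pilotDataOfK T.D).choose (exists_realising_thetaIdeles_pilotDataOfK T.D).choose
              (exists_realising_qIdeles_pilotDataOfK T.D).choose_spec.1 (exists_realising_qIdeles_pilotDataOfK T.D).choose_spec.2.1)) qK :=
  GenuineK.not_pilotKummerCompatHull_chosen_triple_of_thirty_top isABCTriple_1061 T ⟨1061, by norm_num⟩ (by norm_num) (by norm_num) (by norm_num)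
    (show (1061 : ℕ) ≠ l by omega) (show 30 * l + 2 ≤ 1061 by omega) 4 (by norm_num) (dvd_mul_of_dvd_right (by norm_num) _) (by omega)

/-! ## §3. The 25 «DECIDABLE-NOW» rows by explicit list (tree-scan shape) -/

/-- **R-W rows `pilotDataOfK:frey-557832031250-…:l`, `l ∈ {19, 23, 29, 31, 37, 41, 43, 47, 53, 59, 61, 67, 71, 73, 79, 83, 89, 97, 101, 103, 107, 113}` —
REFUTED side, unconditionally** (the 22 «DECIDABLE-NOW» rows of the `3677`-triple; corollary of §1). [cite: Mochizuki2012, IUTchIII Cor. 3.12 Step (xi-f) p. 184]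
[claim: Mochizuki2012, status: disputed] -/
theorem GenuineK.not_pilotKummerCompatHull_chosen_triple_3677_decidableNow {l : ℕ}
    (hl : l ∈ [19, 23, 29, 31, 37, 41, 43, 47, 53, 59, 61, 67, 71, 73, 79, 83, 89, 97, 101, 103, 107, 113])
    (T : Cor22.ThetaVolumeDatumAt (ratPoint (((2 * 5 ^ 10 * 13 ^ 4 : ℕ) : ℚ) / (11 ^ 8 * 109 ^ 2 * 3677 ^ 3 : ℕ))) l) :
    letI := T.instFieldF; letI := T.instNumberFieldF; letI := T.instAlgebraF; letI := T.instFieldK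
    letI := T.instNumberFieldK; letI := T.instAlgebraK; letI := T.instFieldFbar; letI := T.instAlgebraFbar
    letI := T.instAlgebraKFbar; letI := T.instIsElliptic
    ∀ (M : Type) [Field M] [NumberField M]
      (archPk : ∀ (j : (thetaIndex (pilotDataOfK T.D T.K)).Label) (vQ : (thetaIndex (pilotDataOfK T.D T.K)).VQ),
        Set ((logShellsDH (pilotDataOfK T.D T.K) (analyticLogv T.K)).Packet j vQ))
      (archSub : ∀ (j : (thetaIndex (pilotDataOfK T.D T.K)).Label) (v : (thetaIndex (pilotDataOfK T.D T.K)).V),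
        Set ((logShellsDH (pilotDataOfK T.D T.K) (analyticLogv T.K)).Packet j ((thetaIndex (pilotDataOfK T.D T.K)).over v)))
      (Ψ : ℤ → ∀ v : (thetaIndex (pilotDataOfK T.D T.K)).V, v ∈ (thetaIndex (pilotDataOfK T.D T.K)).Vbad →
        Set ((logShellsDH (pilotDataOfK T.D T.K) (analyticLogv T.K)).StarPacket v))
      (act : ℤ → ∀ v : (thetaIndex (pilotDataOfK T.D T.K)).V, v ∈ (thetaIndex (pilotDataOfK T.D T.K)).Vbad →
        (logShellsDH (pilotDataOfK T.D T.K) (analyticLogv T.K)).StarPacket v →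
          Module.End ℚ ((logShellsDH (pilotDataOfK T.D T.K) (analyticLogv T.K)).StarPacket v))
      (Mmod : ℤ → ∀ j : (thetaIndex (pilotDataOfK T.D T.K)).LabelStar, Set ((logShellsDH (pilotDataOfK T.D T.K) (analyticLogv T.K)).GlobalPacket j.1))
      (region : ℤ → ∀ j : (thetaIndex (pilotDataOfK T.D T.K)).LabelStar, FinDivisor M → ∀ vQ : (thetaIndex (pilotDataOfK T.D T.K)).VQ,
        Set ((logShellsDH (pilotDataOfK T.D T.K) (analyticLogv T.K)).Packet j.1 vQ))
      (frobAdm : ℤ → ℤ → ∀ (j : (thetaIndex (pilotDataOfK T.D T.K)).Label) (vQ : (thetaIndex (pilotDataOfK T.D T.K)).VQ),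
        Set ((logShellsDH (pilotDataOfK T.D T.K) (analyticLogv T.K)).Packet j vQ) → Prop)
      (frobLogvol : ℤ → ℤ → ∀ (j : (thetaIndex (pilotDataOfK T.D T.K)).Label) (vQ : (thetaIndex (pilotDataOfK T.D T.K)).VQ),
        Set ((logShellsDH (pilotDataOfK T.D T.K) (analyticLogv T.K)).Packet j vQ) → ℝ)
      (frobΨ : ℤ → ℤ → ∀ v : (thetaIndex (pilotDataOfK T.D T.K)).V, v ∈ (thetaIndex (pilotDataOfK T.D T.K)).Vbad →
        Set ((logShellsDH (pilotDataOfK T.D T.K) (analyticLogv T.K)).StarPacket v))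
      (frobMmod : ℤ → ℤ → ∀ j : (thetaIndex (pilotDataOfK T.D T.K)).LabelStar, Set ((logShellsDH (pilotDataOfK T.D T.K) (analyticLogv T.K)).GlobalPacket j.1))
      (unitImage : ℤ → ℤ → ℕ → ∀ (j : (thetaIndex (pilotDataOfK T.D T.K)).Label) (vQ : (thetaIndex (pilotDataOfK T.D T.K)).VQ),
        Set ((logShellsDH (pilotDataOfK T.D T.K) (analyticLogv T.K)).Packet j vQ))
      (ballImage : ℤ → ℤ → ∀ (j : (thetaIndex (pilotDataOfK T.D T.K)).Label) (vQ : (thetaIndex (pilotDataOfK T.D T.K)).VQ),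
        Set ((logShellsDH (pilotDataOfK T.D T.K) (analyticLogv T.K)).Packet j vQ))
      (thetaDiv : ℤ → ℤ → LgpDivisor M (thetaIndex (pilotDataOfK T.D T.K)).lstar)
      (n : ℤ) {HT : Type} {LogLink : HT → HT → Type} {IsFull : ∀ {s t : HT}, LogLink s t → Prop}
      (lat : LGPGaussianLogThetaLattice LogLink IsFull)
      {Frd : Type} {IsoF : Frd → Frd → Type} {Ob : Frd → Type} {realify : Frd → Frd} {Strip : Type}
      {IsoS : Strip → Strip → Type} {Mv : ∀ v : (thetaIndex (pilotDataOfK T.D T.K)).V, v ∈ (thetaIndex (pilotDataOfK T.D T.K)).Vbad → Type}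
      [∀ v h, Monoid (Mv v h)]
      (sig : GlobalLGPFrobenioidSignature (thetaIndex (pilotDataOfK T.D T.K)).lstar (thetaIndex (pilotDataOfK T.D T.K)).V
        (· ∈ (thetaIndex (pilotDataOfK T.D T.K)).Vbad) Frd IsoF Ob realify Strip IsoS Mv)
      (split : SplittingMonoids Mv) {ObΔ : Type} {N : ∀ v : (thetaIndex (pilotDataOfK T.D T.K)).V, v ∈ (thetaIndex (pilotDataOfK T.D T.K)).Vbad → Type}
      [∀ v h, Monoid (N v h)] (qData : QPilotData ObΔ N)
      (qK : ∀ v : (thetaIndex (pilotDataOfK T.D T.K)).V, v ∈ (thetaIndex (pilotDataOfK T.D T.K)).Vbad →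
        Set ((logShellsDH (pilotDataOfK T.D T.K) (analyticLogv T.K)).StarPacket v)),
      ¬ Cor312Vol.PilotKummerCompatHull
          (LatticeSituation.ofShells (logShellsDH (pilotDataOfK T.D T.K) (analyticLogv T.K)) M archPk archSub
            (summandPiecesPr (pilotDataOfK T.D T.K) (logvAnalytic_analyticLogv (F := T.K))).Adm
            (summandPiecesPr (pilotDataOfK T.D T.K) (logvAnalytic_analyticLogv (F := T.K))).logvol Ψ act Mmod region frobAdm frobLogvol frobΨ
            frobMmod unitImage ballImage thetaDiv)
          (settingPrVolSharp (pilotDataOfK T.D T.K) (logvAnalytic_analyticLogv (F := T.K)) M archPk archSub Ψ act Mmod region n lat sig split qData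
            (exists_realising_qIdeles_pilotDataOfK T.D).choose (exists_realising_thetaIdeles_pilotDataOfK T.D).choose
            (exists_realising_qIdeles_pilotDataOfK T.D).choose_spec.1 (exists_realising_qIdeles_pilotDataOfK T.D).choose_spec.2.1)
          (fun _ => Cor312.Setting.qRegion
            (settingPrVolSharp (pilotDataOfK T.D T.K) (logvAnalytic_analyticLogv (F := T.K)) M archPk archSub Ψ act Mmod region n lat sig split qData
              (exists_realising_qIdeles_pilotDataOfK T.D).choose (exists_realising_thetaIdeles_pilotDataOfK T.D).choose
              (exists_realising_qIdeles_pilotDataOfK T.D).choose_spec.1 (exists_realising_qIdeles_pilotDataOfK T.D).choose_spec.2.1)) qK :=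
  GenuineK.not_pilotKummerCompatHull_chosen_triple_3677_tate (by simp only [List.mem_cons, List.not_mem_nil, or_false] at hl; omega)
    (by simp only [List.mem_cons, List.not_mem_nil, or_false] at hl; omega) T

/-- **R-W rows `pilotDataOfK:frey-377933067-…:l`, `l ∈ {23, 29, 31}` — REFUTED side, unconditionally** (the 3 «DECIDABLE-NOW» rows of the `1061`-triple;
corollary of §2). [cite: Mochizuki2012, IUTchIII Cor. 3.12 Step (xi-f) p. 184] [claim: Mochizuki2012, status: disputed] -/
theorem GenuineK.not_pilotKummerCompatHull_chosen_triple_1061_decidableNow {l : ℕ} (hl : l ∈ [23, 29, 31])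
    (T : Cor22.ThetaVolumeDatumAt (ratPoint (((3 ^ 3 * 241 ^ 3 : ℕ) : ℚ) / (2 ^ 15 * 17 ^ 2 * 331 * 1061 ^ 4 : ℕ))) l) :
    letI := T.instFieldF; letI := T.instNumberFieldF; letI := T.instAlgebraF; letI := T.instFieldK
    letI := T.instNumberFieldK; letI := T.instAlgebraK; letI := T.instFieldFbar; letI := T.instAlgebraFbar
    letI := T.instAlgebraKFbar; letI := T.instIsElliptic
    ∀ (M : Type) [Field M] [NumberField M]
      (archPk : ∀ (j : (thetaIndex (pilotDataOfK T.D T.K)).Label) (vQ : (thetaIndex (pilotDataOfK T.D T.K)).VQ),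
        Set ((logShellsDH (pilotDataOfK T.D T.K) (analyticLogv T.K)).Packet j vQ))
      (archSub : ∀ (j : (thetaIndex (pilotDataOfK T.D T.K)).Label) (v : (thetaIndex (pilotDataOfK T.D T.K)).V),
        Set ((logShellsDH (pilotDataOfK T.D T.K) (analyticLogv T.K)).Packet j ((thetaIndex (pilotDataOfK T.D T.K)).over v)))
      (Ψ : ℤ → ∀ v : (thetaIndex (pilotDataOfK T.D T.K)).V, v ∈ (thetaIndex (pilotDataOfK T.D T.K)).Vbad →
        Set ((logShellsDH (pilotDataOfK T.D T.K) (analyticLogv T.K)).StarPacket v))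
      (act : ℤ → ∀ v : (thetaIndex (pilotDataOfK T.D T.K)).V, v ∈ (thetaIndex (pilotDataOfK T.D T.K)).Vbad →
        (logShellsDH (pilotDataOfK T.D T.K) (analyticLogv T.K)).StarPacket v →
          Module.End ℚ ((logShellsDH (pilotDataOfK T.D T.K) (analyticLogv T.K)).StarPacket v))
      (Mmod : ℤ → ∀ j : (thetaIndex (pilotDataOfK T.D T.K)).LabelStar, Set ((logShellsDH (pilotDataOfK T.D T.K) (analyticLogv T.K)).GlobalPacket j.1))
      (region : ℤ → ∀ j : (thetaIndex (pilotDataOfK T.D T.K)).LabelStar, FinDivisor M → ∀ vQ : (thetaIndex (pilotDataOfK T.D T.K)).VQ,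
        Set ((logShellsDH (pilotDataOfK T.D T.K) (analyticLogv T.K)).Packet j.1 vQ))
      (frobAdm : ℤ → ℤ → ∀ (j : (thetaIndex (pilotDataOfK T.D T.K)).Label) (vQ : (thetaIndex (pilotDataOfK T.D T.K)).VQ),
        Set ((logShellsDH (pilotDataOfK T.D T.K) (analyticLogv T.K)).Packet j vQ) → Prop)
      (frobLogvol : ℤ → ℤ → ∀ (j : (thetaIndex (pilotDataOfK T.D T.K)).Label) (vQ : (thetaIndex (pilotDataOfK T.D T.K)).VQ),
        Set ((logShellsDH (pilotDataOfK T.D T.K) (analyticLogv T.K)).Packet j vQ) → ℝ)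
      (frobΨ : ℤ → ℤ → ∀ v : (thetaIndex (pilotDataOfK T.D T.K)).V, v ∈ (thetaIndex (pilotDataOfK T.D T.K)).Vbad →
        Set ((logShellsDH (pilotDataOfK T.D T.K) (analyticLogv T.K)).StarPacket v))
      (frobMmod : ℤ → ℤ → ∀ j : (thetaIndex (pilotDataOfK T.D T.K)).LabelStar, Set ((logShellsDH (pilotDataOfK T.D T.K) (analyticLogv T.K)).GlobalPacket j.1))
      (unitImage : ℤ → ℤ → ℕ → ∀ (j : (thetaIndex (pilotDataOfK T.D T.K)).Label) (vQ : (thetaIndex (pilotDataOfK T.D T.K)).VQ),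
        Set ((logShellsDH (pilotDataOfK T.D T.K) (analyticLogv T.K)).Packet j vQ))
      (ballImage : ℤ → ℤ → ∀ (j : (thetaIndex (pilotDataOfK T.D T.K)).Label) (vQ : (thetaIndex (pilotDataOfK T.D T.K)).VQ),
        Set ((logShellsDH (pilotDataOfK T.D T.K) (analyticLogv T.K)).Packet j vQ))
      (thetaDiv : ℤ → ℤ → LgpDivisor M (thetaIndex (pilotDataOfK T.D T.K)).lstar)
      (n : ℤ) {HT : Type} {LogLink : HT → HT → Type} {IsFull : ∀ {s t : HT}, LogLink s t → Prop}
      (lat : LGPGaussianLogThetaLattice LogLink IsFull)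
      {Frd : Type} {IsoF : Frd → Frd → Type} {Ob : Frd → Type} {realify : Frd → Frd} {Strip : Type}
      {IsoS : Strip → Strip → Type} {Mv : ∀ v : (thetaIndex (pilotDataOfK T.D T.K)).V, v ∈ (thetaIndex (pilotDataOfK T.D T.K)).Vbad → Type}
      [∀ v h, Monoid (Mv v h)]
      (sig : GlobalLGPFrobenioidSignature (thetaIndex (pilotDataOfK T.D T.K)).lstar (thetaIndex (pilotDataOfK T.D T.K)).V
        (· ∈ (thetaIndex (pilotDataOfK T.D T.K)).Vbad) Frd IsoF Ob realify Strip IsoS Mv)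
      (split : SplittingMonoids Mv) {ObΔ : Type} {N : ∀ v : (thetaIndex (pilotDataOfK T.D T.K)).V, v ∈ (thetaIndex (pilotDataOfK T.D T.K)).Vbad → Type}
      [∀ v h, Monoid (N v h)] (qData : QPilotData ObΔ N)
      (qK : ∀ v : (thetaIndex (pilotDataOfK T.D T.K)).V, v ∈ (thetaIndex (pilotDataOfK T.D T.K)).Vbad →
        Set ((logShellsDH (pilotDataOfK T.D T.K) (analyticLogv T.K)).StarPacket v)),
      ¬ Cor312Vol.PilotKummerCompatHull
          (LatticeSituation.ofShells (logShellsDH (pilotDataOfK T.D T.K) (analyticLogv T.K)) M archPk archSub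
            (summandPiecesPr (pilotDataOfK T.D T.K) (logvAnalytic_analyticLogv (F := T.K))).Adm
            (summandPiecesPr (pilotDataOfK T.D T.K) (logvAnalytic_analyticLogv (F := T.K))).logvol Ψ act Mmod region frobAdm frobLogvol frobΨ
            frobMmod unitImage ballImage thetaDiv)
          (settingPrVolSharp (pilotDataOfK T.D T.K) (logvAnalytic_analyticLogv (F := T.K)) M archPk archSub Ψ act Mmod region n lat sig split qData
            (exists_realising_qIdeles_pilotDataOfK T.D).choose (exists_realising_thetaIdeles_pilotDataOfK T.D).choose
            (exists_realising_qIdeles_pilotDataOfK T.D).choose_spec.1 (exists_realising_qIdeles_pilotDataOfK T.D).choose_spec.2.1)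
          (fun _ => Cor312.Setting.qRegion
            (settingPrVolSharp (pilotDataOfK T.D T.K) (logvAnalytic_analyticLogv (F := T.K)) M archPk archSub Ψ act Mmod region n lat sig split qData
              (exists_realising_qIdeles_pilotDataOfK T.D).choose (exists_realising_thetaIdeles_pilotDataOfK T.D).choose
              (exists_realising_qIdeles_pilotDataOfK T.D).choose_spec.1 (exists_realising_qIdeles_pilotDataOfK T.D).choose_spec.2.1)) qK :=
  GenuineK.not_pilotKummerCompatHull_chosen_triple_1061_thirty (by simp only [List.mem_cons, List.not_mem_nil, or_false] at hl; omega)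
    (by simp only [List.mem_cons, List.not_mem_nil, or_false] at hl; omega) T

end Summit.ABC.IUTFork.Conditional

end
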